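import Summits.Langlands.Langlands.Theses.SteinbergWeightVelocity

/-!
# `WeightVelocity` forces accessibility at every place above `p`
(negative knowledge for crux stmt-Langlands-13450, route SteinbergWeightVelocity)

The conjunct `Ev.IsClassicalPointOf ι x π χ` of `WeightVelocity`, through the structure axiom
`EigenvarietyResGLn.isJacquetExponent_of_isClassicalPointOf`, forces `π` to have at EVERY place
`w ∣ p` a local component with a Jacquet exponent, whereas the hypotheses of the crux constrain `π`
at the single place `v` only.  Hence the crux fails for any datum of its setting with `π_w`
supercuspidal at some `w ∣ p` (paper witness: `n = 2`, `p = 5`, `K = ℚ(√11, i)`, `π` the base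
change of the modular elliptic curve over `ℚ(√11)` with multiplicative reduction at one prime above
`5` and supercuspidal type `e = 6` at the other).  The witness is not constructible in the tree (no
cusp form on `GL_n`, `n ≥ 2`, is), so the refutation is recorded CONDITIONALLY:
`weightVelocity_false_of_inaccessible`.  Repair for the planner (refuted-misstated): add the
accessibility hypothesis `∀ w : PlacesOver K p, ∃ πw χw, π.1.HasLocalComponentAt w.1 πw.ρ ∧
IsJacquetExponent πw χw`. [folklore]
-/

namespace Summit.Langlands.Langlands.Theorems

open Summit.Langlands.Langlands.Theses.SteinbergWeightVelocity
open Literature.NumberTheory.Automorphic Literature.NumberTheory.GaloisRepresentations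
open IsDedekindDomain NumberField

/-- `WeightVelocity` implies: for every datum of its setting there is a refinement exponent `χ`
such that at EVERY `w ∣ p` some local component of `π` has Jacquet exponent `χ_w`
(`isJacquetExponent_of_isClassicalPointOf` applied to the conjunct `IsClassicalPointOf ι x π χ`).
[folklore] -/
theorem weightVelocity_accessible (h : WeightVelocity) (K : Type) [Field K] [NumberField K]
    [IsCMField K] (n : ℕ) (hcpt : isCompact_glFiniteIntegralLevel n K)
    (π : CuspidalAutomorphicRepData n K hcpt) (hn : 2 ≤ n) (hRA : π.1.IsRegularAlgebraic)
    (p : ℕ) [Fact p.Prime] (ι : PadicAlgCl p ≃+* ℂ) (ρ : FramedGaloisRep K (PadicAlgCl p) n)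
    (hss : ρ.toGaloisRep.IsSemisimple)
    (hcompat : ∀ᶠ w : HeightOneSpectrum (𝓞 K) in Filter.cofinite, ∀ α : Multiset ℂ,
      π.1.HasSatakeParamAt w α →
        ρ.IsUnramifiedAt w ∧ ρ.HasFrobCharpolyAt w (arithFrobPolyOfSatake ι w.residueCard n α))
    (v : HeightOneSpectrum (𝓞 K)) (hv : ((p : ℕ) : 𝓞 K) ∈ v.asIdeal)
    (hsec : 3 ≤ n ∨ 2 * (v.asIdeal.ramificationIdx ℤ * v.asIdeal.inertiaDeg ℤ) ≤ Module.finrank ℚ K)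
    (hSt : ∀ (L : LocalLanglandsDatum (v.adicCompletion K))
      (πv : SmoothIrrep (Matrix.GeneralLinearGroup (Fin n) (v.adicCompletion K))),
      π.1.HasLocalComponentAt v πv.ρ → ((L.recGL n (IrrClass.mk πv)).out.1).N ^ (n - 1) ≠ 0) :
    ∃ χ : RefinementExponent K n p, ∀ w : PlacesOver K p,
      ∃ πw : SmoothIrrep (Matrix.GeneralLinearGroup (Fin n) (w.1.adicCompletion K)),
        π.1.HasLocalComponentAt w.1 πw.ρ ∧ IsJacquetExponent πw (χ w) := by
  obtain ⟨S, Ev, x, χ, σ, η, Z, hcl, -⟩ := h K n hcpt π hn hRA p ι ρ hss hcompat v hv hsec hSt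
  exact ⟨χ, fun w => Ev.isJacquetExponent_of_isClassicalPointOf hcl w⟩

/-- **Conditional refutation of `WeightVelocity`**: a datum of its setting with a place `w ∣ p` at
which no local component of `π` has any Jacquet exponent (e.g. `π_w` supercuspidal) contradicts
the crux. [folklore] -/
theorem weightVelocity_false_of_inaccessible (K : Type) [Field K] [NumberField K]
    [IsCMField K] (n : ℕ) (hcpt : isCompact_glFiniteIntegralLevel n K)
    (π : CuspidalAutomorphicRepData n K hcpt) (hn : 2 ≤ n) (hRA : π.1.IsRegularAlgebraic)
    (p : ℕ) [Fact p.Prime] (ι : PadicAlgCl p ≃+* ℂ) (ρ : FramedGaloisRep K (PadicAlgCl p) n)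
    (hss : ρ.toGaloisRep.IsSemisimple)
    (hcompat : ∀ᶠ w : HeightOneSpectrum (𝓞 K) in Filter.cofinite, ∀ α : Multiset ℂ,
      π.1.HasSatakeParamAt w α →
        ρ.IsUnramifiedAt w ∧ ρ.HasFrobCharpolyAt w (arithFrobPolyOfSatake ι w.residueCard n α))
    (v : HeightOneSpectrum (𝓞 K)) (hv : ((p : ℕ) : 𝓞 K) ∈ v.asIdeal)
    (hsec : 3 ≤ n ∨ 2 * (v.asIdeal.ramificationIdx ℤ * v.asIdeal.inertiaDeg ℤ) ≤ Module.finrank ℚ K)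
    (hSt : ∀ (L : LocalLanglandsDatum (v.adicCompletion K))
      (πv : SmoothIrrep (Matrix.GeneralLinearGroup (Fin n) (v.adicCompletion K))),
      π.1.HasLocalComponentAt v πv.ρ → ((L.recGL n (IrrClass.mk πv)).out.1).N ^ (n - 1) ≠ 0)
    (w : PlacesOver K p)
    (hw : ∀ πw : SmoothIrrep (Matrix.GeneralLinearGroup (Fin n) (w.1.adicCompletion K)),
      π.1.HasLocalComponentAt w.1 πw.ρ →
        ∀ χw : (Fin n → (w.1.adicCompletion K)ˣ) →* ℂˣ, ¬ IsJacquetExponent πw χw) :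
    ¬ WeightVelocity := by
  intro h
  obtain ⟨χ, hχ⟩ :=
    weightVelocity_accessible h K n hcpt π hn hRA p ι ρ hss hcompat v hv hsec hSt
  obtain ⟨πw, hloc, hJ⟩ := hχ w
  exact hw πw hloc (χ w) hJ

end Summit.Langlands.Langlands.Theorems
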